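import Literature.MathematicalPhysics.QuantumFieldTheory.Balaban1983to89.B8LeafModelZd3
import Literature.MathematicalPhysics.QuantumFieldTheory.Balaban1983to89.B8Prop6OfThm4
import Literature.MathematicalPhysics.QuantumFieldTheory.Balaban1983to89.B8Eq131Cubes
import Literature.MathematicalPhysics.QuantumFieldTheory.Balaban1983to89.B8Eq106Local

/-!
# `Balaban1983to89.B8LeafModelZd3NonVacuity` — [Balaban1985RegularSpaces] NON-VACUITY CERTIFICATE for the `Ω₀ = ℤᵈ` sub-family of the
# `GFData3` prototype `B8LeafModelZd3.zdGF3`: the sub-index is inhabited at every `(k ≥ 1, η > 0)`, and the hypothesis classes of Theorems 2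
# and 4 — (1.33) `InA`, (1.34) `InAAx`, (1.35) `avgClose`, (1.66) `avgClose166` — are inhabited at EVERY member and every `α₀, α₁ ≥ 0`
# (the pair `U₀ = 1`, `U′ = 1`)

statement-level skeleton of published theorems with citation tags; proofs where landed; nothing here is a claim about the
Yang–Mills mass gap

PDF held: `paper:balaban1985-cmp99-regular-spaces-gauge-fixing` (journal page = PDF page + 74); pp. 77, 79, 81–82, 87.

WHY THIS FILE (cell `pub-ymgap`, seat `pub-ymgap-dag-n05-a` g5; the discharge referee's vacuity audit A1–A6, count-neutral).  The t2 / t4 / p3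
instances `thm2Printed_zd3_univ` / `thm4Printed_zd3` / `prop3Printed_zd3` and the knit `B8LeafKnitZd3.b8LeafRS_zd3_univ` quantify over the
sub-index `{i : ZdIdx d L // i.Ω 0 = Set.univ}` and over data satisfying (1.33)–(1.35)/(1.66).  This file certifies that neither quantifier
is empty: (1) for every `L ≥ 1`, `k ≥ 1`, `η > 0` there is a member with `Ω_j = ℤᵈ` for all `j`, constraint sites `Λs m j = ℤᵈ` at the top
level `j = m` of every truncation (else `∅`), constraint bonds likewise — print's «Ω_j = T_η», 𝔅_k = the top lattice (the admitted family of
`B8Prop7AdmittedFamily`, index `LamTop`), all five laws of `ZdIdx` checked (`hpart` by the floor map `B8Eq131Cubes.flm`); (2) at EVERY member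
of `ZdIdx` the pair `U₀ = 1`, `U′ = 1` satisfies `InA α₀`, `InAAx α₀`, `avgClose α₁`, `avgClose166 α₁` for all `α₀ > 0`, `α₁ ≥ 0`
(`B8Prop6OfThm4.one_inAk`, `B8Eq119TwistedAxial.inAx_self`).

HONEST SCOPE.  Inhabitation only (the A-list's «hypotheses not vacuous»); nothing of Bałaban's is asserted; the sockets' satisfiability is
a different question (they are the in-edges).  Count-neutral; N05 NOT discharged; nothing continuum / ℝ⁴ / OS / mass-gap / Clay.  Unit
`pub-ymgap-dag-n05-a` (g5), 2026-08-26.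
-/

noncomputable section

namespace Literature.MathematicalPhysics.QuantumFieldTheory.Balaban1983to89.B8LeafModelZd3NonVacuity

open B7Prop1Explicit B7Prop2Explicit B7Prop1Local B8Ineq130
open B8Ineq132 (InAk Under)
open B8Eq119TwistedAxial (InAx inAx_self)
open B8Lemma1NonAbelian (mulCfg)
open B8Eq131Cubes (flm under_flm)
open B8Eq106Local (under_iff_tower)
open B8LeafModelZd (ZdIdx)
open B8LeafModelZd3 (zdGF3)

-- `Site` alone could resolve to the torus sites of `Setup.lean`; re-export the `ℤ^d` sites of `B7Prop1Explicit`.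
export B7Prop1Explicit (Site)

variable {d : ℕ}

/-! ## §1 The sub-index `Ω 0 = univ` is inhabited -/

/-- **A member of `ZdIdx d L` with `Ω_j = ℤᵈ` for every `j`** (print p. 77 «we admit the case where some domains Ω_j are equal to T_η»), `k ≥ 1`
levels, lattice spacing `η > 0`, the constraint sites of the truncation at `m` levels = the whole top lattice `j = m` (𝔅_m = T^{(m)}), the
constraint bonds likewise; the PARTITION clause by the floor map (`x ∈ Bᵏ(⌊x/Lᵏ⌋)`).
[cite: Balaban1985RegularSpaces, (1.3)–(1.6) p.77, (1.13) p.78, p.77 («Ω_j = T_η»)] -/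
theorem exists_member_univ {L : ℕ} (hL : 1 ≤ L) {k : ℕ} (hk : 1 ≤ k) {η : ℝ} (hη : 0 < η) :
    ∃ i : ZdIdx d L, i.Ω 0 = Set.univ ∧ i.k = k ∧ i.η = η ∧ (∀ j, i.Ω j = Set.univ) ∧
      (∀ m j, i.Λs m j = {_y | j = m}) ∧ (∀ m j, i.Λb m j = {_c | j = m}) := by
  classical
  refine ⟨⟨η, hη, k, hk, fun _ => Set.univ, fun _ => le_rfl, fun m j => {_y | j = m}, fun m j => {_c | j = m},
      fun _ _ _ _ _ _ _ _ => Set.mem_univ _, ?_, fun _ _ _ _ _ _ => Set.mem_univ _, ?_⟩,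
    rfl, rfl, rfl, fun _ => rfl, fun _ _ => rfl, fun _ _ => rfl⟩
  · intro m _ j _ c hc
    exact Or.inl ⟨hc, hc⟩
  · intro x _
    refine ⟨k, le_rfl, flm L k x, rfl, ?_⟩
    obtain ⟨h1, h2⟩ := (under_iff_tower L k (flm L k x) x).1 (under_flm hL k x)
    exact fun i => ⟨h1 i, h2 i⟩

/-! ## §2 The hypothesis classes of Theorems 2 and 4 are inhabited at every member -/

section Hypotheses

variable {𝔸 : Type} [CStarAlgebra 𝔸]

/-- **(1.33)–(1.35)/(1.66) are satisfied by the pair `U₀ = 1`, `U′ = 1` at every member** (`1 ∈ 𝔄_k` for every `α₀ > 0`,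
`B8Prop6OfThm4.one_inAk`; `1 ∈ Ax_k(ℭ, 1)` for every `ℭ`, `B8Eq119TwistedAxial.inAx_self`; the averages of the same field agree; `‖1 − 1‖ = 0`):
the hypothesis classes of `B8.Thm2Printed` / `B8.Thm4Printed` / `B8.Prop3Printed`'s (1.40) on `zdGF3` are not empty.
[cite: Balaban1985RegularSpaces, (1.33)–(1.35) p.82, (1.66) p.87, p.78 («the surfaces pass through the element U₀»)] -/
theorem hypotheses_inhabited_one {L : ℕ} (hL : 1 ≤ L) (β : ℝ) (len : Site d → ℝ) (i : ZdIdx d L) {α₀ α₁ : ℝ}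
    (hα₀ : 0 < α₀) (hα₁ : 0 ≤ α₁) :
    ∃ (U₀ : (zdGF3 𝔸 L β len i).Cfg) (P : (zdGF3 𝔸 L β len i).Pert),
      (zdGF3 𝔸 L β len i).InA α₀ U₀ ∧ (zdGF3 𝔸 L β len i).Reg335 α₀ U₀ ∧ (zdGF3 𝔸 L β len i).InAAx α₀ U₀ P ∧
        (zdGF3 𝔸 L β len i).avgClose α₁ U₀ P ∧ (zdGF3 𝔸 L β len i).avgClose166 α₁ U₀ P ∧
        (zdGF3 𝔸 L β len i).InAPair α₀ U₀ P := by
  have h1u : ∀ x κ, (1 : Site d → Fin d → 𝔸ˣ) x κ ∈ unitaryUnits 𝔸 := fun _ _ => (unitaryUnits 𝔸).one_mem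
  have hmul : mulCfg (1 : Site d → Fin d → 𝔸ˣ) (1 : Site d → Fin d → 𝔸ˣ) = 1 := by
    rw [B8Thm4Concrete.mulCfg_eq_mul, mul_one]
  have hA : InAk L i.k i.η α₀ i.Ω (1 : Site d → Fin d → 𝔸ˣ) := B8Prop6OfThm4.one_inAk hL i.k i.hη hα₀ _
  refine ⟨⟨1, h1u⟩, (⟨1, h1u⟩, ⟨1, h1u⟩), hA, trivial, ⟨rfl, ?_, ?_⟩, ?_, ⟨?_, ?_⟩, ?_⟩
  · show InAk L i.k i.η α₀ i.Ω (mulCfg 1 1)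
    rw [hmul]; exact hA
  · intro m _
    show InAx L m (i.Λs m) (1 : Site d → Fin d → 𝔸ˣ) (mulCfg 1 1)
    rw [hmul]; exact inAx_self L m (i.Λs m) _
  · intro j _ z μ _
    show ‖((avgIter L (mulCfg 1 (1 : Site d → Fin d → 𝔸ˣ)) j z μ : 𝔸ˣ) : 𝔸) - (avgIter L (1 : Site d → Fin d → 𝔸ˣ) j z μ : 𝔸)‖ ≤ α₁
    rw [hmul, sub_self, norm_zero]; exact hα₁
  · intro j _ z μ _
    show ‖((avgIter L (mulCfg 1 (1 : Site d → Fin d → 𝔸ˣ)) j z μ : 𝔸ˣ) : 𝔸) - (avgIter L (1 : Site d → Fin d → 𝔸ˣ) j z μ : 𝔸)‖ ≤ α₁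
    rw [hmul, sub_self, norm_zero]; exact hα₁
  · intro b _
    show ‖(((1 : Site d → Fin d → 𝔸ˣ) b.1 b.2 : 𝔸ˣ) : 𝔸) - 1‖ ≤ α₁
    rw [Pi.one_apply, Pi.one_apply, Units.val_one, sub_self, norm_zero]; exact hα₁
  · show InAk L i.k i.η α₀ i.Ω (mulCfg 1 1)
    rw [hmul]; exact hA

/-- **Both quantifiers of the univ sub-family's leaf instances are inhabited at once**: for `L, k ≥ 1`, `η > 0`, `α₀ > 0`, `α₁ ≥ 0` there
are a member `i` with `i.Ω 0 = univ` and data `(U₀, P)` in the hypothesis classes (1.33)–(1.35)/(1.66) of `zdGF3 𝔸 L β len i`.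
[cite: Balaban1985RegularSpaces, p.77 («Ω_j = T_η»), (1.33)–(1.35) p.82, (1.66) p.87] -/
theorem univ_subfamily_hypotheses_inhabited {L : ℕ} (hL : 1 ≤ L) (β : ℝ) (len : Site d → ℝ) {k : ℕ} (hk : 1 ≤ k) {η : ℝ}
    (hη : 0 < η) {α₀ α₁ : ℝ} (hα₀ : 0 < α₀) (hα₁ : 0 ≤ α₁) :
    ∃ (i : {i : ZdIdx d L // i.Ω 0 = Set.univ}) (U₀ : (zdGF3 𝔸 L β len i.1).Cfg) (P : (zdGF3 𝔸 L β len i.1).Pert),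
      i.1.k = k ∧ i.1.η = η ∧ (zdGF3 𝔸 L β len i.1).InA α₀ U₀ ∧ (zdGF3 𝔸 L β len i.1).Reg335 α₀ U₀ ∧
        (zdGF3 𝔸 L β len i.1).InAAx α₀ U₀ P ∧ (zdGF3 𝔸 L β len i.1).avgClose α₁ U₀ P ∧
        (zdGF3 𝔸 L β len i.1).avgClose166 α₁ U₀ P := by
  obtain ⟨i, hΩ, hk', hη', -, -, -⟩ := exists_member_univ (d := d) hL hk hη
  obtain ⟨U₀, P, h1, h2, h3, h4, h5, -⟩ := hypotheses_inhabited_one (𝔸 := 𝔸) hL β len i hα₀ hα₁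
  exact ⟨⟨i, hΩ⟩, U₀, P, hk', hη', h1, h2, h3, h4, h5⟩

end Hypotheses

#print axioms exists_member_univ
#print axioms univ_subfamily_hypotheses_inhabited

end Literature.MathematicalPhysics.QuantumFieldTheory.Balaban1983to89.B8LeafModelZd3NonVacuity

end
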